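import Summits.ResolutionOfSingularities.ResolutionOfSingularities.Theorems.PurelyInseparableDim4ResConeHeavyKeepStep
import Summits.ResolutionOfSingularities.ResolutionOfSingularities.Theorems.PurelyInseparableDim4ResConeHeavyLoseTail
import Summits.ResolutionOfSingularities.ResolutionOfSingularities.Theorems.PurelyInseparableDim4ResConeHeavyLinePattern
import Summits.ResolutionOfSingularities.ResolutionOfSingularities.Theorems.PurelyInseparableDim4ResConeKeepBudget
import HarnessLib
import HarnessLib.Audit.Tags

/-!
# Purely inseparable four-folds — TAIL(p, p−1, 2) IS EMPTY FOR EVERY PRIME `p`: no witnessed isolated above-floor `Step0 p`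
# chain has constant shade `p − 1` and binary residual cone (`e_G ≡ 2`) — the ONE-TRACKED-FRAME assembly over the E/K/L step
# triple ∀ (p, d, n) and the moving dock (cell `res-dim4-pi`, K2(p) lane; rung-0 exit table row A1 CLOSED for every prime)

[OURS · counted 0 · cell `res-dim4-pi` · K2(p) lane holder res-dim4-p-12 g5.]  **HONEST LABEL.**  A theorem about OUR MODEL (the
coordinate point-blow-up walk `Step0 p` with cleaning on presented states `(F, r, exc)` of `z^p + F(x₁..x₄)`, ISOLATED regime):
it empties ONE of the `2·(p − 3)` tail statements of the K2(p) ledger (`noAboveFloorTrap_iff_highTails`, p710010) for every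
prime at once — the slot `(d, e) = (p − 1, 2)`.  Nothing here proves K2(p) for any `p ≥ 7` (seven of the eight tails at `p = 7`
remain), `NoIsolatedTrap p p`, CJS Key Theorem 6.40 or resolution of singularities in dimension ≥ 4 / characteristic `p` — NOT
proved.  AI kernel work, weaker than expert review.

WHY THE TOP SHADE IS SPECIAL.  At `d = p − 1` EVERY boundary letter of weight `w ≥ 1` sits on a Φ-line: `r_h + n = p` with
`n = p − w ∈ [1, d]` (critical for `w = 1`, supercritical for `w ≥ 2`), and EVERY newborn letter (weight `|r_k| + d − p ≥ 1`
by the band) does too.  So the three p-GENERIC step laws of the tree apply to ANY letter a frame happens to sit on: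
E = res-dim4-p-9 g5's `heavy_entryFrame` (p709142), K = res-dim4-p-7 g5's `tail_heavy_keep_step` (p710511),
L = res-dim4-p-2 g6's `tail_heavy_lose_step` (p710102) — each with its own `n` per step.

THE ARGUMENT (`no_primeShade_binaryCone_tail`).  (§1) Some step `k₁ ≥ k₀` HITS (charts or translates) a boundary letter of
weight `≥ 1` — otherwise every weighted letter is kept for ever and `|r_k|` grows by the newborn weight `≥ 1` at every step,
against the band `|r_k| + d < 2p` (`exists_weighted_hit`).  (§3) E at `k₁` on that letter, then L across the step, frame the
NEWBORN `j k₁` at `k₁ + 1` (a linear frame `L` with left inverse, `L u₁ = e_{j k₁}`, y-rows annihilating `resVertex`, `μ = d`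
polygon with `pts ≠ ∅`, `d! < δs`, `0 < αs`; value `βs`).  (§2, `no_tail_of_tracked_frame`, abstract) TRACK ONE LETTER: at each
later step, if the tracked letter is HIT the frame passes to the newborn (L, `βs` not larger) and the newborn becomes the tracked
letter; if it is KEPT the frame passes to the same letter (K, `βs` STRICTLY smaller).  Hence the tracked letter is kept at most
`βs₀` times, and res-dim4-p-7 g3's moving dock `no_tail_of_movingKeepCount_le` (‖ K: a tracked letter hit at all but finitely
many steps makes the tail eventually FREE, against FT) closes.  NO class binder, NO weights hypothesis, NO two-letter game.

CONSEQUENCES (by name, elsewhere): the `(p, p−1)` light pair (res-dim4-p-5 g5 `no_light_pair_tail_prime`, p709143), the `(p, p−1)`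
D∞-shape heavy line (res-dim4-p-7 g5 `no_heavyLine_tail`, p710256), TAIL-D at `(5, 4)` (p707872) and the `(p, p−1)` two-letter game
(res-dim4-p-5 g5's socket `no_primeShade_tail_of_noPairTail`) are all special cases; exit-table row A1 (the 66-state zoo at `(7,6)`)
is CLOSED; the K2(p) ledger drops to `2·(p − 3) − 1` tails (`7` at `p = 7`: TAIL(7,3,2), (7,4,2), (7,5,2) and the four power cones).
At `d < p − 1` the argument breaks exactly where the newborn weight `|r_k| + d − p` can be `< p − d` (a frame cannot follow the
hit onto a too-light newborn) — the honest frontier of the Φ-line.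

[cite: CossartJannsenSaito2020, Thm. 3.14, Lemma 13.4 (3), Thm. 13.7] [cite: CossartPiltant2008, (16), Lemma 4.5 (2)]
[cite: HauserPerlega2019PRIMS, §2 (transform D′ of D)]
bears_on: LADDER-RESOLUTION:D157-DOOR2 (res-dim4-pi · K2(p) · TAIL(p, p−1, 2) = ∅ ∀ p · exit-table row A1).  Supports
stmt-ResolutionOfSingularities-16155 (helper).
-/

set_option linter.dupNamespace false -- mandated namespace of this single-conjunct summit

noncomputable section

namespace Summit.ResolutionOfSingularities.ResolutionOfSingularities.Theorems.PIDim4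

namespace ResCone

open MvPolynomial Finset
open Literature.AlgebraicGeometry.Resolution
open Literature.AlgebraicGeometry.Resolution.CentreBlowup
open Literature.AlgebraicGeometry.Resolution.Hauser2010
open Literature.AlgebraicGeometry.Resolution.HauserPerlega2019
open Literature.AlgebraicGeometry.Resolution.WeightedOrder
open PointBlowup (direction)

variable {K : Type} [Field K]

/-! ## 1. Some step hits a weighted boundary letter (weights + band only) -/

section Hit

variable (p : ℕ) [hp : Fact p.Prime] [CharP K p] [DecidableEq K]

omit [CharP K p] in
/-- **SOME STEP HITS A WEIGHTED LETTER.**  Along a witnessed isolated above-floor `Step0 p` chain with `x^{r₀} ∣ F₀` and constant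
shade `d` from `k₀`: after any time `k₂ ≥ k₀` there is a step `k ≥ k₂` that charts or translates a boundary letter of weight
`≥ 1`.  Otherwise every weighted letter is kept for ever while the newborn (weight `|r_k| + d − p ≥ 1`, band) lands on a
weight-`0` letter, so `|r_k|` increases at every step — against `|r_k| + d < 2p`. [OURS · bookkeeping]
[cite: HauserPerlega2019PRIMS, §2 (transform D′ of D)] -/
theorem exists_weighted_hit {c : ℕ → State K} {j : ℕ → Fin 4} {b : ℕ → Fin 4 → K}
    (hc : ∀ k, IsIsolated p (c k).F ∧ Step0 p (c k) (c (k + 1))) (hw : FreeTail.IsWitnessedChain p c j b)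
    (hr0 : ∀ e ∈ (c 0).F.support, (c 0).r ≤ e) (hfloor : ∀ k, ordZero (c k).F ≠ p) {k₀ d : ℕ}
    (hshade : ∀ k, k₀ ≤ k → (c k).shade = (d : ℕ∞)) {k₂ : ℕ} (hk₂ : k₀ ≤ k₂) :
    ∃ k, k₂ ≤ k ∧ ∃ W : Fin 4, 1 ≤ (c k).r W ∧ (j k = W ∨ b k W ≠ 0) := by
  classical
  obtain ⟨-, hlaw, -, hband, -⟩ := tail_weights_laws hc hw hr0 hfloor hshade
  by_contra hno
  push Not at hno
  -- every step from `k₂` keeps all weighted letters, so the total weight grows by `≥ 1`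
  have hgrow : ∀ k, k₂ ≤ k → (c k).r.degree + 1 ≤ (c (k + 1)).r.degree := by
    intro k hk
    have hk0 : k₀ ≤ k := by omega
    have hr1 := hlaw k hk0
    obtain ⟨hpo, -⟩ := hband k hk0
    -- the chart letter weighs `0`
    have hj0 : (c k).r (j k) = 0 := by
      by_contra hj
      exact (hno k hk (j k) (by omega)).1 rfl
    -- pointwise: `r_{k+1} i ≥ r_k i` off the chart, and the chart gains the newborn weight
    have hge : ∀ i, (c k).r i + (if i = j k then (c k).r.degree + d - p else 0) ≤ (c (k + 1)).r i := by
      intro i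
      by_cases hij : i = j k
      · rw [if_pos hij, hij, hj0, hr1, Finsupp.coe_update, Function.update_self]; simp
      · rw [if_neg hij, hr1, Finsupp.coe_update, Function.update_of_ne hij, Finsupp.filter_apply]
        by_cases hbi : b k i = 0
        · rw [if_pos hbi]; simp
        · -- a translated letter must weigh `0`
          have h0 : (c k).r i = 0 := by
            by_contra hri
            exact hbi (hno k hk i (by omega)).2
          rw [if_neg hbi, h0, add_zero]
    have hsum : ∑ i, ((c k).r i + (if i = j k then (c k).r.degree + d - p else 0)) ≤ ∑ i, (c (k + 1)).r i :=
      Finset.sum_le_sum fun i _ => hge i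
    rw [Finset.sum_add_distrib, Finset.sum_ite_eq' Finset.univ (j k), if_pos (Finset.mem_univ _),
      ← Finsupp.degree_eq_sum, ← Finsupp.degree_eq_sum] at hsum
    omega
  -- … which the band forbids
  have hunb : ∀ m, (c k₂).r.degree + m ≤ (c (k₂ + m)).r.degree := by
    intro m
    induction m with
    | zero => simp
    | succ m ih =>
      have := hgrow (k₂ + m) (by omega)
      rw [show k₂ + (m + 1) = k₂ + m + 1 by ring]
      omega
  obtain ⟨-, ho2⟩ := hband (k₂ + 2 * p) (by omega)
  have := hunb (2 * p)
  omega

end Hit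

/-! ## 2. The abstract one-tracked-frame argument -/

section Tracked

variable (p : ℕ) [hp : Fact p.Prime] [CharP K p] [DecidableEq K]

/-- **THE ONE-TRACKED-FRAME ASSEMBLY (abstract, any shade).**  Along a witnessed isolated `Step0 p` chain, suppose run data
`R k i f` (letter `i` framed at time `k` by `f`) with an ℕ-potential `Φ` satisfy, from `k₁` on: (L) a frame of a letter that
the step HITS (charts or translates) passes to a frame of the NEWBORN `j k` with `Φ` not larger; (K) a frame of a letter that
the step KEEPS passes to a frame of the SAME letter with `Φ` strictly smaller.  Then no letter is framed at `k₁`: tracking one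
frame (hit ⇒ follow the newborn, kept ⇒ stay), the tracked letter is kept at most `Φ₀` times, so it is hit at all but
finitely many steps — res-dim4-p-7 g3's moving dock `no_tail_of_movingKeepCount_le` (eventually FREE ⇒ FT). [OURS]
[cite: CossartJannsenSaito2020, Thm. 3.14, Thm. 13.7] -/
theorem no_tail_of_tracked_frame {c : ℕ → State K} {j : ℕ → Fin 4} {b : ℕ → Fin 4 → K}
    (hc : ∀ k, IsIsolated p (c k).F ∧ Step0 p (c k) (c (k + 1))) (hw : FreeTail.IsWitnessedChain p c j b) {k₁ : ℕ}
    {Fr : Type} (R : ℕ → Fin 4 → Fr → Prop) (Φ : ℕ → Fr → ℕ)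
    (hL : ∀ k, k₁ ≤ k → ∀ (h : Fin 4) (f : Fr), R k h f → (j k = h ∨ b k h ≠ 0) →
      ∃ f', R (k + 1) (j k) f' ∧ Φ (k + 1) f' ≤ Φ k f)
    (hK : ∀ k, k₁ ≤ k → ∀ (h : Fin 4) (f : Fr), R k h f → j k ≠ h → b k h = 0 →
      ∃ f', R (k + 1) h f' ∧ Φ (k + 1) f' < Φ k f)
    {h₀ : Fin 4} {f₀ : Fr} (hstart : R k₁ h₀ f₀) : False := by
  classical
  -- the tracked letter, from time `k₁`
  let g : ℕ → Fin 4 := fun m =>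
    Nat.rec (motive := fun _ => Fin 4) h₀
      (fun m (hm : Fin 4) => if j (k₁ + m) = hm ∨ b (k₁ + m) hm ≠ 0 then j (k₁ + m) else hm) m
  have hgs : ∀ m, g (m + 1) = if j (k₁ + m) = g m ∨ b (k₁ + m) (g m) ≠ 0 then j (k₁ + m) else g m :=
    fun m => rfl
  -- invariant: a frame on the tracked letter with `#KEEP-steps so far + Φ ≤ Φ₀`
  have hprop : ∀ m, ∃ f, R (k₁ + m) (g m) f ∧
      ((Finset.range m).filter (fun i => j (k₁ + i) ≠ g i ∧ b (k₁ + i) (g i) = 0)).card + Φ (k₁ + m) f ≤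
        Φ k₁ f₀ := by
    intro m
    induction m with
    | zero => exact ⟨f₀, hstart, by simp⟩
    | succ m ih =>
      obtain ⟨f, hRf, hbound⟩ := ih
      have hcard : ((Finset.range (m + 1)).filter (fun i => j (k₁ + i) ≠ g i ∧ b (k₁ + i) (g i) = 0)).card =
          ((Finset.range m).filter (fun i => j (k₁ + i) ≠ g i ∧ b (k₁ + i) (g i) = 0)).card +
            (if j (k₁ + m) ≠ g m ∧ b (k₁ + m) (g m) = 0 then 1 else 0) := by
        rw [Finset.range_add_one, Finset.filter_insert]
        split_ifs with h2
        · rw [Finset.card_insert_of_notMem (by simp)]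
        · rfl
      have heq : k₁ + (m + 1) = k₁ + m + 1 := by ring
      by_cases hkeep : j (k₁ + m) ≠ g m ∧ b (k₁ + m) (g m) = 0
      · -- KEEP: same letter, `Φ` strictly smaller
        obtain ⟨f', hR', hlt⟩ := hK (k₁ + m) (by omega) (g m) f hRf hkeep.1 hkeep.2
        have hg' : g (m + 1) = g m := by
          rw [hgs, if_neg (not_or.mpr ⟨hkeep.1, not_not.mpr hkeep.2⟩)]
        refine ⟨f', by rw [heq, hg']; exact hR', ?_⟩
        rw [hcard, if_pos hkeep, heq]
        omega
      · -- HIT: follow the newborn, `Φ` not larger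
        have hhit : j (k₁ + m) = g m ∨ b (k₁ + m) (g m) ≠ 0 := by
          by_contra hno
          push Not at hno
          exact hkeep hno
        obtain ⟨f', hR', hle⟩ := hL (k₁ + m) (by omega) (g m) f hRf hhit
        have hg' : g (m + 1) = j (k₁ + m) := by rw [hgs, if_pos hhit]
        refine ⟨f', by rw [heq, hg']; exact hR', ?_⟩
        rw [hcard, if_neg hkeep, heq]
        omega
  -- the moving dock: the tracked letter is kept at most `Φ₀` times
  refine no_tail_of_movingKeepCount_le p hc hw (k₀ := k₁) (fun k => g (k - k₁)) ?_ (B := Φ k₁ f₀) ?_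
  · intro k hk hnot
    have hhit : j k = g (k - k₁) ∨ b k (g (k - k₁)) ≠ 0 := by
      by_contra hno
      push Not at hno
      exact hnot hno
    show g (k + 1 - k₁) = j k
    rw [show k + 1 - k₁ = (k - k₁) + 1 by omega, hgs, show k₁ + (k - k₁) = k by omega, if_pos hhit]
  · intro n
    obtain ⟨f, -, hbound⟩ := hprop n
    simp only [Nat.add_sub_cancel_left]
    exact (Nat.le_add_right _ _).trans hbound

end Tracked

/-! ## 3. TAIL(p, p−1, 2) = ∅: every letter is on a Φ-line at the top shade -/

section PrimeShade

variable (p : ℕ) [hp : Fact p.Prime] [CharP K p] [DecidableEq K]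

/-- **TAIL(p, p−1, 2) IS EMPTY FOR EVERY PRIME `p`.**  There is no witnessed isolated above-floor `Step0 p` chain `c j b` with
`x^{r₀} ∣ F₀` whose shade is `≡ d = p − 1` and whose polar-kernel rank is `e_G ≡ 2` from some time `k₀` on.  Proof:
`exists_weighted_hit` gives a step `k₁ ≥ k₀` hitting a letter `W` of weight `w ≥ 1`; res-dim4-p-9 g5's `heavy_entryFrame`
(`n := p − w ≤ d`) frames `W` at `k₁` and res-dim4-p-2 g6's `tail_heavy_lose_step` (`n := p − w′`, `w′ =` newborn weight) frames
the newborn at `k₁ + 1` with `0 < αs`; then `no_tail_of_tracked_frame` with run datum = «weight `≥ 1` + frame + `0 < αs`»,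
`Φ = βs`, (L) = `tail_heavy_lose_step` (the newborn weighs `|r_k| + d − p ≥ 1`, `tail_newborn_weight`), (K) = res-dim4-p-7 g5's
`tail_heavy_keep_step` (`n := p − r_k h ∈ [1, d]` since `1 ≤ r_k h ≤ p − 2`).  Unconditional; no class binder.  Special cases by
name elsewhere: the light pair ∀ p (p709143), the D∞-shape heavy line ∀ p (p710256), TAIL-D at `(5,4)` (p707872).
[OURS] [cite: CossartJannsenSaito2020, Thm. 3.14, Lemma 13.4 (3), Thm. 13.7] [cite: CossartPiltant2008, (16), Lemma 4.5 (2)] -/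
theorem no_primeShade_binaryCone_tail {c : ℕ → State K} {j : ℕ → Fin 4} {b : ℕ → Fin 4 → K}
    (hc : ∀ k, IsIsolated p (c k).F ∧ Step0 p (c k) (c (k + 1))) (hw : FreeTail.IsWitnessedChain p c j b)
    (hr0 : ∀ e ∈ (c 0).F.support, (c 0).r ≤ e) (hfloor : ∀ k, ordZero (c k).F ≠ p) {k₀ d : ℕ} (hdp : d + 1 = p)
    (hshade : ∀ k, k₀ ≤ k → (c k).shade = (d : ℕ∞))
    (he : ∀ k, k₀ ≤ k → Module.finrank K (resVertex (c k)) = 2) : False := by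
  classical
  have hdp' : d < p := by omega
  obtain ⟨-, hlaw, hbj, hband, hpair⟩ := tail_weights_laws hc hw hr0 hfloor hshade
  -- every weight is `≤ p − 2` (isolation pair law with any other letter)
  have hle : ∀ k (i : Fin 4), (c k).r i ≤ p - 2 := by
    intro k i
    obtain ⟨i', hi'⟩ := exists_ne i
    have := hpair k i i' (Ne.symm hi')
    omega
  -- a kept letter keeps its weight
  have hkept : ∀ k, k₀ ≤ k → ∀ (h : Fin 4), j k ≠ h → b k h = 0 → (c (k + 1)).r h = (c k).r h := by
    intro k hk h hjh hbh
    rw [hlaw k hk, Finsupp.coe_update, Function.update_of_ne (Ne.symm hjh),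
      Finsupp.filter_apply_pos (fun i => b k i = 0) ((c k).r) hbh]
  -- §1: a first hit of a weighted letter
  obtain ⟨k₁, hk₁, W, hW1, hhit⟩ := exists_weighted_hit p hc hw hr0 hfloor hshade (k₂ := k₀) le_rfl
  have hk₁0 : k₀ ≤ k₁ := hk₁
  obtain ⟨hpo₁, ho2₁⟩ := hband k₁ hk₁0
  -- E at `k₁` on `W` (`n := p − r W`), then L across step `k₁` (`n := p − newborn weight`)
  obtain ⟨L₀, M₀, hM₀, hL₀u1, hy₀, hne₀, hδ₀, -⟩ := heavy_entryFrame (p := p) (d := d) (n := p - (c k₁).r W) hdp'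
    (by have := hle k₁ W; omega) hc hw hr0 hfloor hshade he hk₁0 (W := W) (by omega)
    (heavyLine_direction_ne_zero (hbj k₁) hhit)
  obtain ⟨L₁, M₁, ⟨hM₁, hL₁u1, hy₁, hne₁, hδ₁, -⟩, hpos₁, -⟩ := tail_heavy_lose_step (p := p) (d := d)
    (n := p - ((c k₁).r.degree + d - p)) hdp' (by omega) hc hw hr0 hfloor hshade he hk₁0 (by omega)
    (heavyLine_direction_ne_zero (hbj k₁) hhit) hM₀ hL₀u1 hy₀ hne₀ hδ₀
  obtain ⟨hnew₁, hnewpos₁, -, -⟩ := tail_newborn_weight hc hw hr0 hfloor hshade hk₁0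
  -- §2 with run datum = weight ≥ 1 + frame + `0 < αs`, `Φ := βs`
  refine no_tail_of_tracked_frame p hc hw (k₁ := k₁ + 1)
    (Fr := (Fin (2 + 2) → Fin 4 → K) × (Fin 4 → Fin (2 + 2) → K))
    (fun k i f => 1 ≤ (c k).r i ∧
      (∀ t u, ∑ s, f.2 t s * f.1 s u = if t = u then 1 else 0) ∧ f.1 (u1 2) = Pi.single i 1 ∧
      (∀ s, s ≠ u1 2 → s ≠ u2 2 → ∀ w ∈ resVertex (c k), ∑ t, f.1 s t * w t = 0) ∧
      (pts (fun s => algebraMap (MvPolynomial (Fin 4) K) (OriginLocalization K 4) (∑ t, C (f.1 s t) * X t))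
        (Ideal.span {algebraMap (MvPolynomial (Fin 4) K) (OriginLocalization K 4)
            ((c k).F.divMonomial (c k).r)}) d).Nonempty ∧
      Nat.factorial d < deltaS (fun s => algebraMap (MvPolynomial (Fin 4) K) (OriginLocalization K 4) (∑ t, C (f.1 s t) * X t))
        (Ideal.span {algebraMap (MvPolynomial (Fin 4) K) (OriginLocalization K 4)
            ((c k).F.divMonomial (c k).r)}) d ∧
      0 < alphaS (fun s => algebraMap (MvPolynomial (Fin 4) K) (OriginLocalization K 4) (∑ t, C (f.1 s t) * X t))
        (Ideal.span {algebraMap (MvPolynomial (Fin 4) K) (OriginLocalization K 4)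
            ((c k).F.divMonomial (c k).r)}) d)
    (fun k f => betaS (fun s => algebraMap (MvPolynomial (Fin 4) K) (OriginLocalization K 4) (∑ t, C (f.1 s t) * X t))
        (Ideal.span {algebraMap (MvPolynomial (Fin 4) K) (OriginLocalization K 4)
            ((c k).F.divMonomial (c k).r)}) d)
    ?_ ?_ (h₀ := j k₁) (f₀ := ⟨L₁, M₁⟩) ⟨by rw [hnew₁]; exact hnewpos₁, hM₁, hL₁u1, hy₁, hne₁, hδ₁, hpos₁⟩
  · -- (L): the frame follows the hit onto the newborn (weight `≥ 1` by the band)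
    rintro k hk h ⟨L, M⟩ ⟨-, hM, hLu1, hy, hne, hδ, -⟩ hhit'
    have hk0 : k₀ ≤ k := by omega
    obtain ⟨hpo, ho2⟩ := hband k hk0
    obtain ⟨L', M', ⟨hM', hL'u1, hy', hne', hδ', -⟩, hpos', hle'⟩ := tail_heavy_lose_step (p := p) (d := d)
      (n := p - ((c k).r.degree + d - p)) hdp' (by omega) hc hw hr0 hfloor hshade he hk0 (by omega)
      (heavyLine_direction_ne_zero (hbj k) hhit') hM hLu1 hy hne hδ
    obtain ⟨hnew, hnewpos, -, -⟩ := tail_newborn_weight hc hw hr0 hfloor hshade hk0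
    exact ⟨⟨L', M'⟩, ⟨by rw [hnew]; exact hnewpos, hM', hL'u1, hy', hne', hδ', hpos'⟩, hle'⟩
  · -- (K): the frame stays on the kept letter, `βs` drops (`n := p − r_k h ∈ [1, d]`)
    rintro k hk h ⟨L, M⟩ ⟨hw1, hM, hLu1, hy, hne, hδ, hα0⟩ hjh hbh
    have hk0 : k₀ ≤ k := by omega
    have hrle := hle k h
    obtain ⟨L', M', ⟨hM', hL'u1, hy', hne', hδ', -⟩, hpos', hlt'⟩ := tail_heavy_keep_step (p := p) (d := d)
      (n := p - (c k).r h) hdp' (by omega) (by omega) hc hw hr0 hfloor hshade he hk0 (h := h) (by omega) hjh hbh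
      hM hLu1 hy hne hδ hα0
    exact ⟨⟨L', M'⟩, ⟨by rw [hkept k hk0 h hjh hbh]; exact hw1, hM', hL'u1, hy', hne', hδ', hpos'⟩, hlt'⟩

end PrimeShade

end ResCone

end Summit.ResolutionOfSingularities.ResolutionOfSingularities.Theorems.PIDim4

end
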